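import Summits.Ventures.LatticeQCDFlow.Scoring.BlockFactorProcess
import Summits.Ventures.LatticeQCDFlow.Scoring.BartlettKernel

/-!
# Bartlett's formula for a block-factor process with NO Gaussian assumption: `N · cov[Γ̂_N(s), Γ̂_N(t)] → Σ_{m+W}(s,t)`; under the Wick hypothesis `Σ_{m+W}(s,t) = K(t−s) + K(t+s)`

HONEST FRAMING: exact (Metropolis-corrected) sampling algorithms for lattice gauge theory;
figures of merit are autocorrelation/cost numbers at stated couplings and volumes; no
continuum-physics claim.

Venture `LatticeQCDFlow` (cell pub-lqcd), sub-topic `Scoring`; FANOUT row 16 (`su2-base`), GEN-7.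
NEW WORK of the cell over `Scoring/BlockFactorProcess`, GEN-6's `Scoring/LagProductCovariance`
(`acovHat`, `IsWickFamily`), `Scoring/FejerPairSums` and `Scoring/BartlettKernel`; nothing is cited as a
fact.  Printed counterparts NAMED ONLY: Bartlett 1946;
Priestley 1981 eq. (5.3.22) (the general formula with the fourth-cumulant term); Anderson 1971 §8.3.

A file of the LAW-OF-THE-ERROR packet (independent of the CLT files).  It DEFINES the covariance matrix
`Σ_K` used by the joint CLT (`LagProductCLT.tendstoInDistribution_acovHat`) and identifies it as THE LIMIT
OF `N ·` THE EXACT COVARIANCES of the `Γ̂_N(t)` — for any block-factor process, Gaussian or not (so `Σ` silently contains the summed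
fourth cumulant of GEN-6's `BartlettFourthCumulant`) — and, when the process is ALSO a stationary Wick
family (e.g. a Gaussian moving average), with GEN-6's Bartlett kernel `B(s,t) = K(t−s) + K(t+s)`, by
uniqueness of limits (`IsWickFamily.tendsto_covariance_acovHat'`).

## Contents

* Two factor maps on one window length: `identDistrib_blockFactor_pair₂`,
  **`covariance_blockFactor_add₂`** (`cov[X_i, Y_{i+k}] = cov[X_0, Y_k]`), `indepFun_blockFactor₂`.
* `lagCov X P s t k = cov[X_0X_s, X_kX_{k+t}]` (`L_{s,t}(k)`), `lagProdACov X P K s t = L_{s,t}(0) +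
  Σ_{k=1}^{K} (L_{s,t}(k) + L_{t,s}(k))` (`Σ_K`, symmetric; `= Σ_{k∈ℤ} cov[X_0X_s, X_kX_{k+t}]` when the
  covariances vanish beyond `K`);
* `lagProdFactor F W s` (`X_i X_{i+s}` as a block factor on windows of length `m + W + 1`),
  `memLp_lagProd`, **`covariance_lagProd_add`** (`cov[X_iX_{i+s}, X_{i+k}X_{i+k+t}] = L_{s,t}(k)`),
  **`lagCov_eq_zero`** (`L_{s,t}(k) = 0` for `k > m + W`), `lagCovInt` (the signed-distance form `g`),
  `covariance_lagProd` (`cov[X_iX_{i+s}, X_jX_{j+t}] = g(j − i)`), `summable_lagCovInt`,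
  `tsum_lagCovInt` (`Σ_ℤ g = Σ_{m+W}(s,t)`), **`covariance_acovHat_blockFactor`** (the EXACT
  `cov[Γ̂_N(s), Γ̂_N(t)] = N⁻² Σ_{i,j<N} g(j−i)`), **`tendsto_covariance_acovHat_blockFactor`**
  (BARTLETT'S FORMULA: `N · cov → Σ_{m+W}(s,t)`, Fejér/Tannery).
* **`lagProdACov_eq_bartlettKernel`** — block factor AND stationary Wick family with summable `c`:
  `Σ_{m+W}(s,t) = bartlettKernel c s t`.

NOT CLAIMED: an explicit fourth-cumulant decomposition of `Σ` for a given `F` (GEN-6's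
`BartlettFourthCumulant` has the general identity); anything at finite `N` beyond the exact formula.
-/

noncomputable section

open MeasureTheory ProbabilityTheory Filter Finset
open scoped Topology

namespace Summit.Ventures.LatticeQCDFlow.Scoring

variable {Ω : Type*} [MeasurableSpace Ω] {P : Measure Ω}
variable {S : Type*} [MeasurableSpace S] {ξ : ℕ → Ω → S} {m : ℕ} {F G : (Fin (m + 1) → S) → ℝ}

/-! ## Two block factors of the same window length: joint stationarity -/

omit [MeasurableSpace Ω] [MeasurableSpace S] in
/-- The pair `(X_a, Y_{a+k})` for two factor maps `F`, `G` as ONE function of the window of length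
`k + m + 1` at `a`. -/
theorem blockFactor_pair_eq₂ (F G : (Fin (m + 1) → S) → ℝ) (ξ : ℕ → Ω → S) (a k : ℕ) :
    (fun ω => (blockFactor F ξ a ω, blockFactor G ξ (a + k) ω))
      = fun ω => (fun w : Fin (k + m + 1) → S =>
          (F (fun j : Fin (m + 1) => w ⟨0 + j, by omega⟩),
            G (fun j : Fin (m + 1) => w ⟨k + j, by omega⟩))) (window ξ (k + m + 1) a ω) := by
  funext ω
  simp only [blockFactor_apply, window_add, add_zero]

/-- **Joint stationarity of two block factors**: `(X_i, Y_{i+k})` has the law of `(X_0, Y_k)`. -/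
theorem identDistrib_blockFactor_pair₂ (hind : iIndepFun ξ P)
    (hid : ∀ i, IdentDistrib (ξ i) (ξ 0) P P) (hF : Measurable F) (hG : Measurable G) (i k : ℕ) :
    IdentDistrib (fun ω => (blockFactor F ξ i ω, blockFactor G ξ (i + k) ω))
      (fun ω => (blockFactor F ξ 0 ω, blockFactor G ξ k ω)) P P := by
  have h0 : (fun ω => (blockFactor F ξ 0 ω, blockFactor G ξ k ω))
      = fun ω => (blockFactor F ξ 0 ω, blockFactor G ξ (0 + k) ω) := by
    simp only [zero_add]
  rw [h0, blockFactor_pair_eq₂ F G ξ i k, blockFactor_pair_eq₂ F G ξ 0 k]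
  have hm : Measurable fun w : Fin (k + m + 1) → S =>
      (F (fun j : Fin (m + 1) => w ⟨0 + j, by omega⟩),
        G (fun j : Fin (m + 1) => w ⟨k + j, by omega⟩)) :=
    Measurable.prodMk (hF.comp (measurable_pi_lambda _ fun _ => measurable_pi_apply _))
      (hG.comp (measurable_pi_lambda _ fun _ => measurable_pi_apply _))
  exact (identDistrib_window hind hid (k + m + 1) i).comp hm

/-- **Cross-covariance stationarity**: `cov[X_i, Y_{i+k}] = cov[X_0, Y_k]` for two block factors. -/
theorem covariance_blockFactor_add₂ [IsProbabilityMeasure P] (hind : iIndepFun ξ P)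
    (hid : ∀ i, IdentDistrib (ξ i) (ξ 0) P P) (hF : Measurable F) (hG : Measurable G)
    (hF2 : MemLp (blockFactor F ξ 0) 2 P) (hG2 : MemLp (blockFactor G ξ 0) 2 P) (i k : ℕ) :
    cov[blockFactor F ξ i, blockFactor G ξ (i + k); P]
      = cov[blockFactor F ξ 0, blockFactor G ξ k; P] := by
  have hp := identDistrib_blockFactor_pair₂ hind hid hF hG i k
  have hmF := fun a => memLp_blockFactor hind hid hF hF2 a
  have hmG := fun a => memLp_blockFactor hind hid hG hG2 a
  rw [covariance_eq_sub (hmF i) (hmG (i + k)), covariance_eq_sub (hmF 0) (hmG k)]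
  have e1 : P[blockFactor F ξ i * blockFactor G ξ (i + k)]
      = P[blockFactor F ξ 0 * blockFactor G ξ k] :=
    (hp.comp (u := fun p : ℝ × ℝ => p.1 * p.2) (by fun_prop)).integral_eq
  rw [e1, integral_blockFactor hind hid hF i, integral_blockFactor hind hid hG (i + k),
    integral_blockFactor hind hid hG k]

/-- **Cross `m`-dependence**: `X_i ⟂ Y_j` for `j ≥ i + m + 1`, two block factors. -/
theorem indepFun_blockFactor₂ (hξ : ∀ i, Measurable (ξ i)) (hind : iIndepFun ξ P)
    (hF : Measurable F) (hG : Measurable G) {i j : ℕ} (hij : i + (m + 1) ≤ j) :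
    IndepFun (blockFactor F ξ i) (blockFactor G ξ j) P :=
  (indepFun_window hξ hind hij).comp hF hG

/-! ## Lag products as block factors and the covariances of the empirical autocovariances -/

section LagProducts

/-- The COVARIANCE OF LAG PRODUCTS at distance `k`: `L_{s,t}(k) = cov[X_0 X_s, X_k X_{k+t}]`. [ours] -/
def lagCov (X : ℕ → Ω → ℝ) (P : Measure Ω) (s t k : ℕ) : ℝ :=
  cov[fun ω => X 0 ω * X s ω, fun ω => X k ω * X (k + t) ω; P]

/-- The ASYMPTOTIC COVARIANCE MATRIX of the empirical autocovariances of a `K`-dependent series: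
`Σ_K(s,t) = L_{s,t}(0) + Σ_{k=1}^{K} (L_{s,t}(k) + L_{t,s}(k))` (`= Σ_{k∈ℤ} cov[X_0X_s, X_kX_{k+t}]`,
symmetric). [ours] -/
def lagProdACov (X : ℕ → Ω → ℝ) (P : Measure Ω) (K s t : ℕ) : ℝ :=
  lagCov X P s t 0 + ∑ k ∈ range K, (lagCov X P s t (k + 1) + lagCov X P t s (k + 1))

/-- The lag product `X_i X_{i+s}` (`s ≤ W`) is the block factor of the product map on windows of
length `m + W + 1`. [ours] -/
def lagProdFactor (F : (Fin (m + 1) → S) → ℝ) (W : ℕ) (s : Fin (W + 1)) :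
    (Fin (m + W + 1) → S) → ℝ :=
  fun w => F (fun j : Fin (m + 1) => w ⟨0 + j, by omega⟩) * F (fun j : Fin (m + 1) => w ⟨s + j, by omega⟩)

omit [MeasurableSpace Ω] in
/-- `lagProdFactor` is measurable. -/
theorem measurable_lagProdFactor (hF : Measurable F) (W : ℕ) (s : Fin (W + 1)) :
    Measurable (lagProdFactor F W s) :=
  (hF.comp (measurable_pi_lambda _ fun _ => measurable_pi_apply _)).mul
    (hF.comp (measurable_pi_lambda _ fun _ => measurable_pi_apply _))

omit [MeasurableSpace Ω] [MeasurableSpace S] in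
/-- Along the sequence `lagProdFactor F W s` reads `X_i X_{i+s}`. -/
theorem blockFactor_lagProdFactor (F : (Fin (m + 1) → S) → ℝ) (ξ : ℕ → Ω → S) (W : ℕ)
    (s : Fin (W + 1)) (i : ℕ) :
    blockFactor (lagProdFactor F W s) ξ i
      = fun ω => blockFactor F ξ i ω * blockFactor F ξ (i + s) ω := by
  funext ω
  simp only [blockFactor_apply, lagProdFactor, window_add, add_zero]

/-- Square integrability of the lag products at every position, from position `0`. -/
theorem memLp_lagProd (hind : iIndepFun ξ P) (hid : ∀ i, IdentDistrib (ξ i) (ξ 0) P P)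
    (hF : Measurable F) (h4 : ∀ t, MemLp (fun ω => blockFactor F ξ 0 ω * blockFactor F ξ t ω) 2 P)
    (i t : ℕ) : MemLp (fun ω => blockFactor F ξ i ω * blockFactor F ξ (i + t) ω) 2 P :=
  ((identDistrib_blockFactor_pair hind hid hF i t).comp (u := fun q : ℝ × ℝ => q.1 * q.2)
    (by fun_prop)).symm.memLp_snd (h4 t)

/-- **Stationarity of the lag-product covariances**: `cov[X_iX_{i+s}, X_{i+k}X_{i+k+t}] = L_{s,t}(k)`. -/
theorem covariance_lagProd_add [IsProbabilityMeasure P] (hind : iIndepFun ξ P) (hid : ∀ i, IdentDistrib (ξ i) (ξ 0) P P)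
    (hF : Measurable F) (h4 : ∀ t, MemLp (fun ω => blockFactor F ξ 0 ω * blockFactor F ξ t ω) 2 P)
    {W : ℕ} (s t : Fin (W + 1)) (i k : ℕ) :
    cov[fun ω => blockFactor F ξ i ω * blockFactor F ξ (i + s) ω,
        fun ω => blockFactor F ξ (i + k) ω * blockFactor F ξ (i + k + t) ω; P]
      = lagCov (blockFactor F ξ) P s t k := by
  have h := covariance_blockFactor_add₂ (m := m + W) hind hid (measurable_lagProdFactor hF W s)
    (measurable_lagProdFactor hF W t) ?_ ?_ i k
  · simpa only [blockFactor_lagProdFactor, lagCov, zero_add] using h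
  · rw [blockFactor_lagProdFactor]; simpa only [zero_add] using h4 s
  · rw [blockFactor_lagProdFactor]; simpa only [zero_add] using h4 t

/-- **The lag-product covariances vanish beyond the range**: `L_{s,t}(k) = 0` for `k > m + W`
(`s, t ≤ W`). -/
theorem lagCov_eq_zero (hξ : ∀ i, Measurable (ξ i)) (hind : iIndepFun ξ P)
    (hid : ∀ i, IdentDistrib (ξ i) (ξ 0) P P) (hF : Measurable F)
    (h4 : ∀ t, MemLp (fun ω => blockFactor F ξ 0 ω * blockFactor F ξ t ω) 2 P)
    {W : ℕ} (s t : Fin (W + 1)) {k : ℕ} (hk : m + W < k) :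
    lagCov (blockFactor F ξ) P s t k = 0 := by
  have h := (indepFun_blockFactor₂ (m := m + W) hξ hind (measurable_lagProdFactor hF W s)
    (measurable_lagProdFactor hF W t) (i := 0) (j := k) (by omega)).covariance_eq_zero ?_ ?_
  · simpa only [blockFactor_lagProdFactor, lagCov, zero_add] using h
  · rw [blockFactor_lagProdFactor]; simpa only [zero_add] using h4 s
  · rw [blockFactor_lagProdFactor]; simpa only [zero_add] using memLp_lagProd hind hid hF h4 k t

/-- The covariance of two lag products at arbitrary positions, as a function of the signed distance:
`g(z) = L_{s,t}(z)` for `z ≥ 0`, `L_{t,s}(−z)` for `z < 0`. [ours] -/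
def lagCovInt (X : ℕ → Ω → ℝ) (P : Measure Ω) (s t : ℕ) (z : ℤ) : ℝ :=
  if 0 ≤ z then lagCov X P s t z.toNat else lagCov X P t s (-z).toNat

/-- `cov[X_iX_{i+s}, X_jX_{j+t}] = g(j − i)`. -/
theorem covariance_lagProd [IsProbabilityMeasure P] (hind : iIndepFun ξ P) (hid : ∀ i, IdentDistrib (ξ i) (ξ 0) P P)
    (hF : Measurable F) (h4 : ∀ t, MemLp (fun ω => blockFactor F ξ 0 ω * blockFactor F ξ t ω) 2 P)
    {W : ℕ} (s t : Fin (W + 1)) (i j : ℕ) :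
    cov[fun ω => blockFactor F ξ i ω * blockFactor F ξ (i + s) ω,
        fun ω => blockFactor F ξ j ω * blockFactor F ξ (j + t) ω; P]
      = lagCovInt (blockFactor F ξ) P s t ((j : ℤ) - i) := by
  rcases le_or_gt i j with h | h
  · obtain ⟨k, rfl⟩ := Nat.exists_eq_add_of_le h
    rw [covariance_lagProd_add hind hid hF h4 s t i k, lagCovInt,
      if_pos (by push_cast; linarith)]
    congr 1
    push_cast
    simp
  · obtain ⟨k, rfl⟩ := Nat.exists_eq_add_of_le h.le
    rw [covariance_comm, covariance_lagProd_add hind hid hF h4 t s j k, lagCovInt,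
      if_neg (by push_cast; omega)]
    congr 1
    push_cast
    ring_nf
    simp

/-- `g` is finitely supported (`|z| ≤ m + W`), hence summable. -/
theorem summable_lagCovInt (hξ : ∀ i, Measurable (ξ i)) (hind : iIndepFun ξ P)
    (hid : ∀ i, IdentDistrib (ξ i) (ξ 0) P P) (hF : Measurable F)
    (h4 : ∀ t, MemLp (fun ω => blockFactor F ξ 0 ω * blockFactor F ξ t ω) 2 P)
    {W : ℕ} (s t : Fin (W + 1)) :
    Summable (lagCovInt (blockFactor F ξ) P s t) := by
  refine summable_of_ne_finset_zero (s := Finset.Icc (-((m + W : ℕ) : ℤ)) (m + W : ℕ)) fun z hz => ?_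
  simp only [Finset.mem_Icc, not_and_or, not_le] at hz
  unfold lagCovInt
  split_ifs with h0
  · exact lagCov_eq_zero hξ hind hid hF h4 s t (by omega)
  · exact lagCov_eq_zero hξ hind hid hF h4 t s (by omega)

/-- `Σ_{z∈ℤ} g(z) = Σ_{m+W}(s,t)`. -/
theorem tsum_lagCovInt (hξ : ∀ i, Measurable (ξ i)) (hind : iIndepFun ξ P)
    (hid : ∀ i, IdentDistrib (ξ i) (ξ 0) P P) (hF : Measurable F)
    (h4 : ∀ t, MemLp (fun ω => blockFactor F ξ 0 ω * blockFactor F ξ t ω) 2 P)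
    {W : ℕ} (s t : Fin (W + 1)) :
    ∑' z, lagCovInt (blockFactor F ξ) P s t z = lagProdACov (blockFactor F ξ) P (m + W) s t := by
  rw [tsum_int_eq_zero_add_tsum_nat (summable_lagCovInt hξ hind hid hF h4 s t), lagProdACov]
  have h0 : lagCovInt (blockFactor F ξ) P s t 0 = lagCov (blockFactor F ξ) P s t 0 := by
    simp [lagCovInt]
  have hn : ∀ n : ℕ, lagCovInt (blockFactor F ξ) P s t ((n : ℤ) + 1)
      + lagCovInt (blockFactor F ξ) P s t (-((n : ℤ) + 1))
      = lagCov (blockFactor F ξ) P s t (n + 1) + lagCov (blockFactor F ξ) P t s (n + 1) := by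
    intro n
    unfold lagCovInt
    rw [if_pos (by positivity), if_neg (by omega), neg_neg]
    congr 2
  rw [h0]
  simp_rw [hn]
  congr 1
  refine tsum_eq_sum fun n hn' => ?_
  simp only [mem_range, not_lt] at hn'
  rw [lagCov_eq_zero hξ hind hid hF h4 s t (by omega), lagCov_eq_zero hξ hind hid hF h4 t s (by omega),
    add_zero]

/-- **The exact covariance of the empirical autocovariances of a block-factor process**:
`cov[Γ̂_N(s), Γ̂_N(t)] = N⁻² Σ_{i,j<N} g(j − i)`. -/
theorem covariance_acovHat_blockFactor [IsProbabilityMeasure P] (hind : iIndepFun ξ P)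
    (hid : ∀ i, IdentDistrib (ξ i) (ξ 0) P P) (hF : Measurable F)
    (h4 : ∀ t, MemLp (fun ω => blockFactor F ξ 0 ω * blockFactor F ξ t ω) 2 P)
    {W : ℕ} (s t : Fin (W + 1)) (N : ℕ) :
    cov[acovHat (blockFactor F ξ) N s, acovHat (blockFactor F ξ) N t; P]
      = (∑ i ∈ range N, ∑ j ∈ range N, lagCovInt (blockFactor F ξ) P s t ((j : ℤ) - i))
        / (N : ℝ) ^ 2 := by
  unfold acovHat
  rw [covariance_fun_div_left, covariance_fun_div_right,
    covariance_fun_sum_fun_sum' (fun i _ => memLp_lagProd hind hid hF h4 i s)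
      (fun j _ => memLp_lagProd hind hid hF h4 j t)]
  simp_rw [covariance_lagProd hind hid hF h4]
  rw [div_div, ← sq]

/-- **BARTLETT'S FORMULA FOR A BLOCK-FACTOR PROCESS (no Gaussian assumption, fourth cumulants
included)**: `N · cov[Γ̂_N(s), Γ̂_N(t)] → Σ_{m+W}(s,t) = Σ_{|k|≤m+W} cov[X_0X_s, X_kX_{k+t}]`. -/
theorem tendsto_covariance_acovHat_blockFactor [IsProbabilityMeasure P] (hξ : ∀ i, Measurable (ξ i)) (hind : iIndepFun ξ P)
    (hid : ∀ i, IdentDistrib (ξ i) (ξ 0) P P) (hF : Measurable F)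
    (h4 : ∀ t, MemLp (fun ω => blockFactor F ξ 0 ω * blockFactor F ξ t ω) 2 P)
    {W : ℕ} (s t : Fin (W + 1)) :
    Tendsto (fun N : ℕ => (N : ℝ) * cov[acovHat (blockFactor F ξ) N s, acovHat (blockFactor F ξ) N t; P])
      atTop (𝓝 (lagProdACov (blockFactor F ξ) P (m + W) s t)) := by
  have h := tendsto_sum_sum_int_sub_div (summable_lagCovInt hξ hind hid hF h4 s t)
  rw [tsum_lagCovInt hξ hind hid hF h4] at h
  refine h.congr fun N => ?_
  rw [covariance_acovHat_blockFactor hind hid hF h4, IsWickFamily.natCast_mul_div_sq]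

end LagProducts

/-! ## Under the Wick hypothesis the limit is Bartlett's kernel -/

section Wick

variable [IsProbabilityMeasure P]

/-- **`Σ_{m+W}(s,t) = B(s,t)` for a block-factor process that is also a stationary Wick family**
(e.g. a Gaussian moving average): the two expressions are limits of the same sequence
(`tendsto_covariance_acovHat_blockFactor`, GEN-6's `IsWickFamily.tendsto_covariance_acovHat'`). -/
theorem lagProdACov_eq_bartlettKernel (hξ : ∀ i, Measurable (ξ i)) (hind : iIndepFun ξ P)
    (hid : ∀ i, IdentDistrib (ξ i) (ξ 0) P P) (hF : Measurable F)
    {C : ℕ → ℕ → ℝ} {c : ℤ → ℝ} (hW : IsWickFamily (blockFactor F ξ) C P)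
    (hC : ∀ i j, C i j = c ((j : ℤ) - i)) (hc : Summable c) {W : ℕ} (s t : Fin (W + 1)) :
    lagProdACov (blockFactor F ξ) P (m + W) s t = bartlettKernel c s t :=
  tendsto_nhds_unique (tendsto_covariance_acovHat_blockFactor hξ hind hid hF (fun t => hW.memLp 0 t) s t)
    (hW.tendsto_covariance_acovHat' hC hc s t)

end Wick

end Summit.Ventures.LatticeQCDFlow.Scoring

end
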